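import Summits.AtomisticToContinuum.Crystallization.Theorems.ThreeConeCertificateSlackRigidityPricedFloorsDefs
import Summits.AtomisticToContinuum.Crystallization.Theorems.ThreeConeCertificateSlackRigidityLawSelection
import HarnessLib

/-!
# `SlackRigidity` (stmt-AtomisticToContinuum-11960), line `priced-floors-palm-exactification`:
# the cluster-selection engine for an abstract measurable event

Stub `stub_clusterSelection` of the skeleton of lead c19.  This is the selection theorem
`SlackRigidityLawSelection.exists_badCluster` (p131361, line `ekeland-surgery-parity`) made GENERIC in
the event: for a point-stationary probability law `P` on configurations of `ℝ³`, a.s. rooted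
`δ`-hard-core and minimising (`E_P[h] ≤ e*`), and ANY measurable event `G` with `P(Gᶜ) ≠ 0`, there is
`b > 0` (namely `P(Gᶜ)/4`) such that for every deepness radius `R`, slack `η > 0` and size `M` some
finite cluster `T` inside a `δ`-separated sample `S` (the cluster `T = rootCell L v ∩ S` of an
a.e.-typical sample `count|S` at some phase `v` of the cubic grid of a large mesh `L`) has `#T ≥ M`,
energy `𝓔(T) ≤ #T e* + η #T`, and at least `b · #T` points `y ∈ T` that are `R`-DEEP
(`S ∩ B̄(y, R) ⊆ T`) and BAD (`θ_y (count|S) ∉ G`).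

Proof (selection by averaging, verbatim the structure of `exists_badCluster`): the cell-averaging
identity (`SlackRigidityLawCellAverage`) for the bad functional `f_B(μ, v) = 1[μ ∉ G] · 1[v deep_R]`
gives `E_P[∫ cellAvg f_B] = P(Gᶜ) · vol(deep) > β V/2` for `L` large (`SlackRigidityLawBad`), for the
energy functional `E_P[∫ cellAvg f_E] ≤ V · ofReal (e* + C_δ) + E_P[err_L]/12`
(`SlackRigidityLawEnergy`); pointwise, `cellAvg f_B ≤ #{deep-bad points of T}/#T`
(`cellAvg_deepBad_le`, the only new ingredient: a deep phase puts the closed `R`-ball about `y`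
inside the cell, `closedBall_subset_rootCell_of_deep`) and `cellAvg f_E = ofReal (𝓔(T)/#T + C_δ)`.
If no cluster had the required properties, `cellAvg f_B ≤ ofReal b + (cellAvg f_E - c)/ofReal τ`
pointwise (`τ = min η τ_M`, small clusters have excess rate `> τ_M`), and integrating gives
`β V/2 < β V/4 + β V/8`, absurd (`SlackRigidityLawSelection.absurd_of_ineq`).  All `[folklore]`.
-/

noncomputable section

open MeasureTheory Filter Set
open scoped ENNReal BigOperators Topology

namespace Summit.AtomisticToContinuum.Crystallization.Theorems.SlackRigidityPricedFloorsSelection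

open Literature.Probability.Process
open Literature.MathematicalPhysics.StatisticalMechanics (lennardJones interactionEnergy groundStateEnergy
  rootEnergy)
open Summit.AtomisticToContinuum.Crystallization.Theorems.PalmUnimodularRigidityMinimiserShells.EnergyFloor
open Summit.AtomisticToContinuum.Crystallization.Theorems.MinimiserShells.Negative.LoadBearing (eStar)
open Summit.AtomisticToContinuum.Crystallization.Theorems.SlackRigidityPricedFloors
open Summit.AtomisticToContinuum.Crystallization.Theorems.SlackRigidityLawCellAverage
  (lintegral_phase_eq_cellAverage)
open Summit.AtomisticToContinuum.Crystallization.Theorems.SlackRigidityLawEnergy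
open Summit.AtomisticToContinuum.Crystallization.Theorems.SlackRigidityLawBad
open Summit.AtomisticToContinuum.Crystallization.Theorems.SlackRigidityLawSelection
  (exists_pos_lt_excessRate absurd_of_ineq)

variable {R δ L : ℝ} {G : Set (Measure E3)} {S : Set E3}

/-! ## IN for the bad functional: the cell average is at most the deep-bad fraction of the cluster -/

/-- **IN bound for the bad functional, pointwise, deep-bad form.** At the configuration `count|S`, a
phase `v` with cluster `T = rootCell L v ∩ S` (`L > 0`), the cell average of
`f_B(μ, v) = 1[μ ∉ G] · 1[v deep_R]` is at most the fraction of points `y ∈ T` that are `R`-deep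
(`S ∩ B̄(y, R) ⊆ T`: on a deep phase the closed `R`-ball about `y` lies in the cell,
`closedBall_subset_rootCell_of_deep`) and bad (`θ_y (count|S) ∉ G`). [folklore] -/
theorem cellAvg_deepBad_le (hL : 0 < L) {T : Finset E3} {v : E3} (hT : (↑T : Set E3) = rootCell L v ∩ S) :
    (∫⁻ y in rootCell L v, Gᶜ.indicator (1 : Measure E3 → ℝ≥0∞)
        (((Measure.count : Measure E3).restrict S).map fun z => z - y) *
        {v : E3 | ∀ i, ((⌊-v i⌋ : ℤ) : ℝ) ≤ -R / L - v i ∧ R / L - v i < ⌊-v i⌋ + 1}.indicator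
          (1 : E3 → ℝ≥0∞) (v - L⁻¹ • y) ∂((Measure.count : Measure E3).restrict S)) /
      ((Measure.count : Measure E3).restrict S) (rootCell L v) ≤
    (Nat.card {y : T // S ∩ Metric.closedBall (y : E3) R ⊆ ↑T ∧
        ((Measure.count : Measure E3).restrict S).map (fun z => z - (y : E3)) ∉ G} : ℝ≥0∞) / T.card := by
  -- adapted from ThreeConeCertificateSlackRigidityLawBad (`cellAvg_bad_le`)
  classical
  rw [setLIntegral_rootCell_eq_sum hT, count_restrict_rootCell_eq_card hT]
  gcongr
  rw [← sum_boole_eq_natCard T (fun y => S ∩ Metric.closedBall y R ⊆ ↑T ∧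
    ((Measure.count : Measure E3).restrict S).map (fun z => z - y) ∉ G)]
  refine Finset.sum_le_sum fun y hy => ?_
  have hyS : y ∈ rootCell L v ∩ S := by rw [← hT]; exact hy
  by_cases hG' : (((Measure.count : Measure E3).restrict S).map fun z => z - y) ∈ G
  · rw [Set.indicator_of_notMem (fun h : _ ∈ Gᶜ => h hG'), zero_mul]; exact bot_le
  by_cases hv : (v - L⁻¹ • y) ∈ {v : E3 | ∀ i, ((⌊-v i⌋ : ℤ) : ℝ) ≤ -R / L - v i ∧
      R / L - v i < ⌊-v i⌋ + 1}
  · -- both indicators are `1`: `y` is deep (its closed `R`-ball lies in the cell) and bad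
    have hyR : Metric.closedBall y R ⊆ rootCell L v := by
      intro z hz
      have hz' : z - y ∈ Metric.closedBall (0 : E3) R := by
        rwa [Metric.mem_closedBall, dist_zero_right, ← dist_eq_norm]
      have h := closedBall_subset_rootCell_of_deep hL hv hz'
      have h' : z ∈ (fun w => w - y) ⁻¹' rootCell L (v - L⁻¹ • y) := h
      rwa [preimage_sub_rootCell hL.ne' hyS.1] at h'
    have hb : S ∩ Metric.closedBall y R ⊆ ↑T ∧
        ((Measure.count : Measure E3).restrict S).map (fun z => z - y) ∉ G :=
      ⟨fun z hz => by rw [hT]; exact ⟨hyR hz.2, hz.1⟩, hG'⟩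
    rw [if_pos hb, Set.indicator_of_mem (show _ ∈ Gᶜ from hG'), Set.indicator_of_mem hv]
    simp
  · rw [Set.indicator_of_notMem hv, mul_zero]; exact bot_le

/-! ## The pointwise bound -/

/-- **Pointwise selection inequality.** If no cluster `T ⊆ S` (`S` `δ`-separated) of size `≥ M`,
energy `≤ #T e* + η #T` and deep-bad count `≥ b #T` exists, then at every rooted `δ`-hard-core
configuration and every phase the cell average of the bad functional is at most
`ofReal b + (cellAvg f_E - c)/ofReal τ`, `c = ofReal (e* + C_δ)`, `τ = min η τ_M`; and `c ≤ cellAvg f_E`.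
[folklore] -/
theorem pointwise_bound (hδ : 0 < δ) (hL : 0 < L) {M : ℕ} {η b τ : ℝ} (hτ : 0 < τ)
    (hτη : τ ≤ η) (hsize : ∀ n : ℕ, 0 < n → n ≤ M → τ < groundStateEnergy lennardJones 3 n / n - eStar)
    (hc : -cst δ ≤ eStar)
    (hnone : ∀ (S : Set E3) (T : Finset E3), (∀ x ∈ S, ∀ y ∈ S, x ≠ y → δ ≤ dist x y) →
      (↑T : Set E3) ⊆ S → M ≤ T.card →
      interactionEnergy lennardJones (fun i : Fin T.card => ((T.equivFin.symm i : T) : E3)) ≤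
        (T.card : ℝ) * eStar + η * T.card →
      (Nat.card {y : T // S ∩ Metric.closedBall (y : E3) R ⊆ ↑T ∧
        ((Measure.count : Measure E3).restrict S).map (fun z => z - (y : E3)) ∉ G} : ℝ) < b * T.card)
    {μ : Measure E3} (hμ : IsRootedHardCore δ μ) (v : E3) :
    (∫⁻ y in rootCell L v, Gᶜ.indicator (1 : Measure E3 → ℝ≥0∞) (μ.map fun z => z - y) *
        {v : E3 | ∀ i, ((⌊-v i⌋ : ℤ) : ℝ) ≤ -R / L - v i ∧ R / L - v i < ⌊-v i⌋ + 1}.indicator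
          (1 : E3 → ℝ≥0∞) (v - L⁻¹ • y) ∂μ) / μ (rootCell L v) ≤
      ENNReal.ofReal b + ((∫⁻ y in rootCell L v, ENNReal.ofReal (locEnergy δ (μ.map fun z => z - y)
        (rootCell L (v - L⁻¹ • y)) + cst δ) ∂μ) / μ (rootCell L v) - ENNReal.ofReal (eStar + cst δ)) /
        ENNReal.ofReal τ ∧
    ENNReal.ofReal (eStar + cst δ) ≤ (∫⁻ y in rootCell L v, ENNReal.ofReal (locEnergy δ (μ.map fun z => z - y)
        (rootCell L (v - L⁻¹ • y)) + cst δ) ∂μ) / μ (rootCell L v) := by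
  -- adapted from ThreeConeCertificateSlackRigidityLawSelection (`pointwise_bound`)
  obtain ⟨S, h0, hsep, rfl⟩ := hμ
  obtain ⟨T, hT, h0T⟩ := exists_cluster hδ hL h0 hsep v
  have hB := cellAvg_deepBad_le (R := R) (G := G) hL hT
  have hEq := cellAvg_energy_eq hδ hL h0 hsep hT
  have hTS : (↑T : Set E3) ⊆ S := by rw [hT]; exact Set.inter_subset_right
  have hcard : 0 < T.card := Finset.card_pos.2 ⟨0, h0T⟩
  have hcr : (0 : ℝ) < T.card := by exact_mod_cast hcard
  set E : ℝ := interactionEnergy lennardJones (fun i : Fin T.card => ((T.equivFin.symm i : T) : E3)) with hEdef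
  set Y : ℝ := E / T.card - eStar with hYdef
  have hY : 0 ≤ Y := excess_per_particle_nonneg hcard
  have hc0 : 0 ≤ eStar + cst δ := by linarith
  have hEq' : (∫⁻ y in rootCell L v, ENNReal.ofReal (locEnergy δ
      ((((Measure.count : Measure E3).restrict S).map fun z => z - y)) (rootCell L (v - L⁻¹ • y)) + cst δ)
      ∂((Measure.count : Measure E3).restrict S)) / ((Measure.count : Measure E3).restrict S) (rootCell L v) =
      ENNReal.ofReal Y + ENNReal.ofReal (eStar + cst δ) := by
    rw [hEq, ← ENNReal.ofReal_add hY hc0]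
    congr 1
    rw [hYdef]; ring
  set q : ℝ≥0∞ := (Nat.card {y : T // S ∩ Metric.closedBall (y : E3) R ⊆ ↑T ∧
    ((Measure.count : Measure E3).restrict S).map (fun z => z - (y : E3)) ∉ G} : ℝ≥0∞) / T.card
    with hqdef
  have hctop : ENNReal.ofReal (eStar + cst δ) ≠ ∞ := ENNReal.ofReal_ne_top
  refine ⟨?_, by rw [hEq']; exact le_add_self⟩
  -- the case analysis
  have key : q ≤ ENNReal.ofReal b ∨ τ < Y := by
    by_cases hM : M ≤ T.card
    · by_cases hEn : E ≤ (T.card : ℝ) * eStar + η * T.card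
      · left
        have hlt := hnone S T hsep hTS hM hEn
        have hq : q = ENNReal.ofReal ((Nat.card {y : T // S ∩ Metric.closedBall (y : E3) R ⊆ ↑T ∧
            ((Measure.count : Measure E3).restrict S).map (fun z => z - (y : E3)) ∉ G} : ℝ) /
            T.card) := by
          rw [hqdef, ENNReal.ofReal_div_of_pos hcr, ENNReal.ofReal_natCast, ENNReal.ofReal_natCast]
        rw [hq]
        exact ENNReal.ofReal_le_ofReal ((div_lt_iff₀ hcr).2 hlt).le
      · right
        push Not at hEn
        have : eStar + η < E / T.card := by
          rw [lt_div_iff₀ hcr]; linarith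
        linarith
    · right
      push Not at hM
      have hs := hsize T.card hcard hM.le
      have hge : groundStateEnergy lennardJones 3 T.card ≤ E :=
        Literature.MathematicalPhysics.StatisticalMechanics.groundStateEnergy_lennardJones_le (injective_enum T)
      have : groundStateEnergy lennardJones 3 T.card / T.card ≤ E / T.card :=
        div_le_div_of_nonneg_right hge hcr.le
      linarith
  rcases key with hq | hYτ
  · exact hB.trans (hq.trans le_self_add)
  · have h1 : (1 : ℝ≥0∞) ≤ ((∫⁻ y in rootCell L v, ENNReal.ofReal (locEnergy δ
        ((((Measure.count : Measure E3).restrict S).map fun z => z - y)) (rootCell L (v - L⁻¹ • y)) + cst δ)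
        ∂((Measure.count : Measure E3).restrict S)) / ((Measure.count : Measure E3).restrict S) (rootCell L v) -
        ENNReal.ofReal (eStar + cst δ)) / ENNReal.ofReal τ := by
      rw [hEq', ENNReal.add_sub_cancel_right hctop, ENNReal.le_div_iff_mul_le
        (Or.inl ((ENNReal.ofReal_pos.2 hτ).ne')) (Or.inl ENNReal.ofReal_ne_top), one_mul]
      exact ENNReal.ofReal_le_ofReal hYτ.le
    have hq1 : q ≤ 1 := by
      rw [hqdef, ENNReal.div_le_iff_le_mul (Or.inl (by exact_mod_cast hcard.ne'))
        (Or.inl (ENNReal.natCast_ne_top _)), one_mul]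
      exact_mod_cast (Nat.card_le_card_of_injective _ Subtype.val_injective).trans_eq (Nat.card_eq_finsetCard T)
    exact hB.trans (hq1.trans (h1.trans le_add_self))

/-! ## Integration of the pointwise bound -/

/-- **Integrated selection inequality** (inner integral): for a rooted hard-core configuration,
`∫ cellAvg f_B dv ≤ ofReal b · V + (∫ cellAvg f_E dv - c V) / ofReal τ`. [folklore] -/
theorem setLIntegral_bound (hδ : 0 < δ) (hL : 0 < L) {M : ℕ} {η b τ : ℝ} (hτ : 0 < τ)
    (hτη : τ ≤ η) (hsize : ∀ n : ℕ, 0 < n → n ≤ M → τ < groundStateEnergy lennardJones 3 n / n - eStar)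
    (hc : -cst δ ≤ eStar)
    (hnone : ∀ (S : Set E3) (T : Finset E3), (∀ x ∈ S, ∀ y ∈ S, x ≠ y → δ ≤ dist x y) →
      (↑T : Set E3) ⊆ S → M ≤ T.card →
      interactionEnergy lennardJones (fun i : Fin T.card => ((T.equivFin.symm i : T) : E3)) ≤
        (T.card : ℝ) * eStar + η * T.card →
      (Nat.card {y : T // S ∩ Metric.closedBall (y : E3) R ⊆ ↑T ∧
        ((Measure.count : Measure E3).restrict S).map (fun z => z - (y : E3)) ∉ G} : ℝ) < b * T.card)
    {μ : Measure E3} (hμ : IsRootedHardCore δ μ) :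
    ∫⁻ v in phaseDom, (∫⁻ y in rootCell L v, Gᶜ.indicator (1 : Measure E3 → ℝ≥0∞)
        (μ.map fun z => z - y) *
        {v : E3 | ∀ i, ((⌊-v i⌋ : ℤ) : ℝ) ≤ -R / L - v i ∧ R / L - v i < ⌊-v i⌋ + 1}.indicator
          (1 : E3 → ℝ≥0∞) (v - L⁻¹ • y) ∂μ) / μ (rootCell L v) ≤
      ENNReal.ofReal b * volume phaseDom +
        ((∫⁻ v in phaseDom, (∫⁻ y in rootCell L v, ENNReal.ofReal (locEnergy δ (μ.map fun z => z - y)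
          (rootCell L (v - L⁻¹ • y)) + cst δ) ∂μ) / μ (rootCell L v)) -
          ENNReal.ofReal (eStar + cst δ) * volume phaseDom) / ENNReal.ofReal τ := by
  -- adapted from ThreeConeCertificateSlackRigidityLawSelection (`setLIntegral_bound`)
  have hpt := fun v => pointwise_bound (R := R) (G := G) hδ hL hτ hτη hsize hc hnone hμ v
  have hτ0 : ENNReal.ofReal τ ≠ 0 := (ENNReal.ofReal_pos.2 hτ).ne'
  have hcV : ENNReal.ofReal (eStar + cst δ) * volume phaseDom ≠ ∞ :=
    ENNReal.mul_ne_top ENNReal.ofReal_ne_top volume_phaseDom_ne_top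
  calc _ ≤ ∫⁻ v in phaseDom, (ENNReal.ofReal b + ((∫⁻ y in rootCell L v, ENNReal.ofReal (locEnergy δ
          (μ.map fun z => z - y) (rootCell L (v - L⁻¹ • y)) + cst δ) ∂μ) / μ (rootCell L v) -
          ENNReal.ofReal (eStar + cst δ)) / ENNReal.ofReal τ) := lintegral_mono fun v => (hpt v).1
    _ = ENNReal.ofReal b * volume phaseDom + ∫⁻ v in phaseDom, ((∫⁻ y in rootCell L v,
          ENNReal.ofReal (locEnergy δ (μ.map fun z => z - y) (rootCell L (v - L⁻¹ • y)) + cst δ) ∂μ) /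
          μ (rootCell L v) - ENNReal.ofReal (eStar + cst δ)) / ENNReal.ofReal τ := by
        rw [lintegral_add_left measurable_const, setLIntegral_const, mul_comm]
    _ = ENNReal.ofReal b * volume phaseDom + (∫⁻ v in phaseDom, ((∫⁻ y in rootCell L v,
          ENNReal.ofReal (locEnergy δ (μ.map fun z => z - y) (rootCell L (v - L⁻¹ • y)) + cst δ) ∂μ) /
          μ (rootCell L v) - ENNReal.ofReal (eStar + cst δ))) / ENNReal.ofReal τ := by
        congr 1
        simp_rw [ENNReal.div_eq_inv_mul]
        rw [lintegral_const_mul' _ _ (ENNReal.inv_ne_top.2 hτ0)]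
    _ = _ := by
        congr 2
        rw [lintegral_sub measurable_const (by rw [setLIntegral_const]; exact hcV)
          (ae_of_all _ fun v => (hpt v).2), setLIntegral_const, mul_comm]

/-! ## The selection theorem -/

/-- **Selection of a deep-bad cluster.** For a point-stationary probability law `P`, a.s. rooted
`δ`-hard-core, with `E_P[h] ≤ e*`, and a measurable event `G` with `P(Gᶜ) ≠ 0`, there is `b > 0` such
that for every `R`, every `η > 0` and every `M` some finite cluster `T` inside a `δ`-separated sample `S`
has `#T ≥ M`, `𝓔(T) ≤ #T e* + η #T` and at least `b #T` points `y` with `S ∩ B̄(y, R) ⊆ T` and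
`θ_y (count|S) ∉ G`. [folklore] -/
theorem exists_deepBadCluster (hδ : 0 < δ) (P : Measure (Measure E3)) [IsProbabilityMeasure P]
    (hcore : ∀ᵐ μ ∂P, IsRootedHardCore δ μ) (hstat : IsPointStationaryLaw P)
    (hE : (∫ μ, rootEnergy lennardJones μ ∂P) ≤ eStar) (hGm : MeasurableSet G) (hbad : P Gᶜ ≠ 0) :
    ClusterSelectionFor δ G := by
  -- adapted from ThreeConeCertificateSlackRigidityLawSelection (`exists_badCluster`)
  set β : ℝ≥0∞ := P Gᶜ with hβdef
  have hβt : β ≠ ∞ := measure_ne_top P _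
  have hβpos : 0 < β.toReal := ENNReal.toReal_pos hbad hβt
  refine ⟨β.toReal / 4, by positivity, fun R η M hη => ?_⟩
  by_contra hcon
  have hnone : ∀ (S : Set E3) (T : Finset E3), (∀ x ∈ S, ∀ y ∈ S, x ≠ y → δ ≤ dist x y) →
      (↑T : Set E3) ⊆ S → M ≤ T.card →
      interactionEnergy lennardJones (fun i : Fin T.card => ((T.equivFin.symm i : T) : E3)) ≤
        (T.card : ℝ) * eStar + η * T.card →
      (Nat.card {y : T // S ∩ Metric.closedBall (y : E3) R ⊆ ↑T ∧
        ((Measure.count : Measure E3).restrict S).map (fun z => z - (y : E3)) ∉ G} : ℝ) <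
        β.toReal / 4 * T.card :=
    fun S T hsep hTS hM hEn => lt_of_not_ge fun h' => hcon ⟨S, T, hsep, hTS, hM, hEn, h'⟩
  -- thresholds
  obtain ⟨τ₁, hτ₁, hsize₁⟩ := exists_pos_lt_excessRate M
  set τ : ℝ := min η τ₁ with hτdef
  have hτ : 0 < τ := lt_min hη hτ₁
  have hτη : τ ≤ η := min_le_left _ _
  have hsize : ∀ n : ℕ, 0 < n → n ≤ M → τ < groundStateEnergy lennardJones 3 n / n - eStar :=
    fun n hn hM => (min_le_right _ _).trans_lt (hsize₁ n hn hM)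
  have hc : -cst δ ≤ eStar := neg_cst_le_eStar hδ P hcore hE
  set V : ℝ≥0∞ := volume phaseDom with hVdef
  have hV0 : V ≠ 0 := volume_phaseDom_ne_zero
  have hVt : V ≠ ∞ := volume_phaseDom_ne_top
  set κ : ℝ≥0∞ := ENNReal.ofReal τ * (β * V / 8) with hκdef
  have hκ0 : 0 < κ := by
    refine pos_iff_ne_zero.2 (mul_ne_zero (ENNReal.ofReal_pos.2 hτ).ne' ?_)
    exact (ENNReal.div_pos_iff.2 ⟨mul_ne_zero hbad hV0, by norm_num⟩).ne'
  -- choose the mesh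
  have hev1 : ∀ᶠ n : ℕ in atTop, V / 2 < volume (phaseDom ∩ {v : E3 | ∀ i,
      ((⌊-v i⌋ : ℤ) : ℝ) ≤ -R / ((n : ℝ) + 1) - v i ∧ R / ((n : ℝ) + 1) - v i < ⌊-v i⌋ + 1}) :=
    (tendsto_volume_deep R).eventually (Ioi_mem_nhds (ENNReal.half_lt_self hV0 hVt))
  have hev2 : ∀ᶠ n : ℕ in atTop, ENNReal.ofReal (1 / 12) * ∫⁻ μ, errTerm ((n : ℝ) + 1) μ ∂P < κ := by
    have h := ENNReal.Tendsto.const_mul (tendsto_lintegral_errTerm hδ P hcore) (Or.inr ENNReal.ofReal_ne_top)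
      (a := ENNReal.ofReal (1 / 12))
    rw [mul_zero] at h
    exact h.eventually (Iio_mem_nhds hκ0)
  obtain ⟨n, hn1, hn2⟩ := (hev1.and hev2).exists
  set L : ℝ := (n : ℝ) + 1 with hLdef
  have hL : 0 < L := by positivity
  -- the bad identity: `β · vol(deep) = E[∫ cellAvg f_B]`
  have hBout := lintegral_badFunctional_eq hGm L R P
  have hBid := lintegral_phase_eq_cellAverage hδ hL (measurable_badFunctional hGm L R)
    (badFunctional_periodic G L R) hcore hstat
  -- the energy bound: `E[∫ cellAvg f_E] ≤ V c + κ`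
  have hEle := (lintegral_cellAvg_energy_le hδ hL P hcore hstat hE).trans (add_le_add le_rfl hn2.le)
  -- integrate the pointwise bound
  have hcV : ENNReal.ofReal (eStar + cst δ) * V ≠ ∞ := ENNReal.mul_ne_top ENNReal.ofReal_ne_top hVt
  have hτ0 : ENNReal.ofReal τ ≠ 0 := (ENNReal.ofReal_pos.2 hτ).ne'
  have hinner := fun μ (hμ : IsRootedHardCore δ μ) => setLIntegral_bound (R := R) (G := G) hδ hL hτ hτη
    hsize hc hnone hμ
  have hlow : ∀ᵐ μ ∂P, ENNReal.ofReal (eStar + cst δ) * V ≤ ∫⁻ v in phaseDom, (∫⁻ y in rootCell L v,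
      ENNReal.ofReal (locEnergy δ (μ.map fun z => z - y) (rootCell L (v - L⁻¹ • y)) + cst δ) ∂μ) /
      μ (rootCell L v) := hcore.mono fun μ hμ => by
    calc ENNReal.ofReal (eStar + cst δ) * V = ∫⁻ _v in phaseDom, ENNReal.ofReal (eStar + cst δ) := by
          rw [setLIntegral_const, mul_comm]
      _ ≤ _ := lintegral_mono fun v => (pointwise_bound (R := R) (G := G) hδ hL hτ hτη hsize hc hnone hμ v).2
  have hmain : β * volume (phaseDom ∩ {v : E3 | ∀ i, ((⌊-v i⌋ : ℤ) : ℝ) ≤ -R / L - v i ∧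
      R / L - v i < ⌊-v i⌋ + 1}) ≤ ENNReal.ofReal (β.toReal / 4) * V + κ / ENNReal.ofReal τ := by
    rw [← hBout, hBid]
    calc _ ≤ ∫⁻ μ, (ENNReal.ofReal (β.toReal / 4) * V + ((∫⁻ v in phaseDom, (∫⁻ y in rootCell L v,
            ENNReal.ofReal (locEnergy δ (μ.map fun z => z - y) (rootCell L (v - L⁻¹ • y)) + cst δ) ∂μ) /
            μ (rootCell L v)) - ENNReal.ofReal (eStar + cst δ) * V) / ENNReal.ofReal τ) ∂P :=
          lintegral_mono_ae (hcore.mono fun μ hμ => hinner μ hμ)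
      _ = ENNReal.ofReal (β.toReal / 4) * V + (∫⁻ μ, ((∫⁻ v in phaseDom, (∫⁻ y in rootCell L v,
            ENNReal.ofReal (locEnergy δ (μ.map fun z => z - y) (rootCell L (v - L⁻¹ • y)) + cst δ) ∂μ) /
            μ (rootCell L v)) - ENNReal.ofReal (eStar + cst δ) * V) ∂P) / ENNReal.ofReal τ := by
          rw [lintegral_add_left measurable_const, lintegral_const, measure_univ, mul_one]
          congr 1
          simp_rw [ENNReal.div_eq_inv_mul]
          rw [lintegral_const_mul' _ _ (ENNReal.inv_ne_top.2 hτ0)]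
      _ = ENNReal.ofReal (β.toReal / 4) * V + ((∫⁻ μ, (∫⁻ v in phaseDom, (∫⁻ y in rootCell L v,
            ENNReal.ofReal (locEnergy δ (μ.map fun z => z - y) (rootCell L (v - L⁻¹ • y)) + cst δ) ∂μ) /
            μ (rootCell L v)) ∂P) - ENNReal.ofReal (eStar + cst δ) * V) / ENNReal.ofReal τ := by
          congr 2
          rw [lintegral_sub measurable_const (by rw [lintegral_const, measure_univ, mul_one]; exact hcV) hlow,
            lintegral_const, measure_univ, mul_one]
      _ ≤ ENNReal.ofReal (β.toReal / 4) * V + κ / ENNReal.ofReal τ := by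
          gcongr
          rw [tsub_le_iff_right, add_comm, mul_comm]
          exact hEle
  -- the absurd inequality
  have hb4 : ENNReal.ofReal (β.toReal / 4) = β / 4 := by
    rw [ENNReal.ofReal_div_of_pos (by norm_num : (0 : ℝ) < 4), ENNReal.ofReal_toReal hβt,
      ENNReal.ofReal_ofNat]
  rw [hb4] at hmain
  exact absurd_of_ineq hbad hβt hVt hn1 le_rfl hτ0 ENNReal.ofReal_ne_top hmain

/-- **Registered stub `stub_clusterSelection`** (crux stmt-AtomisticToContinuum-11960, line
`priced-floors-palm-exactification`): the cluster-selection engine for a minimising point-stationary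
hard-core law and an arbitrary measurable event of positive failure probability. [folklore] -/
theorem stub_clusterSelection : ∀ δ : ℝ, 0 < δ → ∀ P : Measure (Measure E3), IsProbabilityMeasure P → IsMinimisingLaw δ P → ∀ G : Set (Measure E3), MeasurableSet G → P Gᶜ ≠ 0 → ClusterSelectionFor δ G := by
  intro δ hδ P hP hlaw G hGm hbad
  haveI := hP
  obtain ⟨hcore, hstat, hE⟩ := hlaw
  exact exists_deepBadCluster hδ P hcore hstat hE hGm hbad

end Summit.AtomisticToContinuum.Crystallization.Theorems.SlackRigidityPricedFloorsSelection

end
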